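import Summits.CriticalPhenomena.PercolationContinuityZ3.Theorems.Transplant.FKConnectivityAllQPat3MinorGraphCone
import Summits.CriticalPhenomena.PercolationContinuityZ3.Theorems.Transplant.FKConnectivityAllQPat3CutMarked
import HarnessLib

/-!
# Connectivity correlation inequalities for `φ_{w,q}`, every `q > 0` — CORNER / 1-CUT / MARKED-1-CUT product-cone lemmas on MINORS

Proof file (`--supports stmt-CriticalPhenomena-4575`), census lineage (gen 37) of LANE 2's FK sub-programme; builds on p205010
(kernel theorem, internal audit signed; external expert review pending).  No definitions, no named facts, no sorries.

The two-piece cut laws of census g36's Stage S3 (`…Pat3CornerCone`, `…Pat3CutOne`, `…Pat3CutMarked`) for MINORS `(E_i, C_i)` of the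
pieces: census g36's C-decompositions `FK.tvalC_union2_corner/cut1/cutS` (`…Pat3GluingC`) embedded as three-piece laws with an empty
third piece (`FK.hdec_cornerC/cut1C/cutSC`) and fed to census g37's `FK.cone3C_level_nonneg_sym`:
**`FK.cornerC_level_nonneg_of_symCertG`** (validity from `IsTTSP` of the ambient pieces via `FK.Gen.lev2C_nonneg`),
**`FK.cut1C_level_nonneg_of_symCert`**, **`FK.cutSC_level_nonneg_of_symCert`** (validity hypotheses).  The certificates are the
SAME table inequalities as for `C = ∅`.
[cite: AyyerLinussonRavichandran2025, §7 (p. 22)] [cite: Grimmett2006, §3.8 (pp. 61–62)]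
-/

noncomputable section

namespace Summit.CriticalPhenomena.PercolationContinuityZ3.Theorems

namespace FK

open SimpleGraph Literature.Probability.LatticeModels Literature.Probability.Percolation
open scoped Classical

variable {V : Type*} [Fintype V]

section MinorCuts

/-- The contracted exponent of the empty minor is `2|V|`. [folklore] -/
theorem apExpC_empty_empty : apExpC (∅ : Finset (Sym2 V)) ∅ ∅ = 2 * Fintype.card V := by
  rw [apExpC_empty, apExp_empty]

/-- All three generators of a two-generator product pass `FK.Gen.okC`. [folklore] -/
def Prod2G.okC (p : Prod2G) : Bool := p.g1.okC && p.g2.okC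

omit [Fintype V] in
/-- The dummy generator is levelwise nonnegative on any minor. [folklore] -/
theorem lev2C_one2_nonneg (E C : Finset (Sym2 V)) (x y s : V) (μ : ℕ) : 0 ≤ lev2C E C x y s one2 μ :=
  lev2C_nonneg_of_coef E C x y s (fun c P Q => by rcases c with _ | c <;> simp [one2]) μ

omit [Fintype V] in
/-- The bit indicators are levelwise nonnegative on any minor. [folklore] -/
theorem lev2C_bitTab_nonneg (β β' : Bool) (E C : Finset (Sym2 V)) (x y s : V) (μ : ℕ) :
    0 ≤ lev2C E C x y s (bitTab β β') μ :=
  lev2C_nonneg_of_coef E C x y s (fun c P Q => by unfold bitTab; split_ifs <;> norm_num) μ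

omit [Fintype V] in
/-- The mixed bit indicator is levelwise nonnegative on any minor. [folklore] -/
theorem lev2C_bitMix_nonneg (E C : Finset (Sym2 V)) (x y s : V) (μ : ℕ) : 0 ≤ lev2C E C x y s bitMix μ :=
  lev2C_nonneg_of_coef E C x y s (fun c P Q => by unfold bitMix; split_ifs <;> norm_num) μ

omit [Fintype V] in
/-- Flip-orbit indicators are levelwise nonnegative on any minor. [folklore] -/
theorem lev2C_orbTab_nonneg (P₀ Q₀ : Pat3) (E C : Finset (Sym2 V)) (x y s : V) (μ : ℕ) :
    0 ≤ lev2C E C x y s (orbTab P₀ Q₀) μ :=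
  lev2C_nonneg_of_coef E C x y s (fun c P Q => by unfold orbTab; split_ifs <;> norm_num) μ

variable {N₁ N₂ E₁ C₁ E₂ C₂ : Finset (Sym2 V)} {V₁ V₂ : Set V}

/-! #### CORNER -/

/-- The CORNER decomposition of a glued minor in the three-piece shape (empty third piece, offset `4|V|`). [folklore] -/
theorem hdec_cornerC (hdN : Disjoint N₁ N₂) (h₁ : ∀ e ∈ (↑N₁ : Set (Sym2 V)), ∀ z ∈ e, z ∈ V₁)
    (h₂ : ∀ e ∈ (↑N₂ : Set (Sym2 V)), ∀ z ∈ e, z ∈ V₂) (hE₁ : E₁ ⊆ N₁) (hC₁ : C₁ ⊆ N₁) (hE₂ : E₂ ⊆ N₂) (hC₂ : C₂ ⊆ N₂)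
    {u v : V} (h12 : V₁ ∩ V₂ ⊆ ({u, v} : Set V)) (huv : u ≠ v)
    {s t : V} (hs2 : s ∉ V₂) (ht1 : t ∉ V₁) (hsu : s ≠ u) (hsv : s ≠ v) (htu : t ≠ u) (htv : t ≠ v) (hst : s ≠ t)
    (w : ℕ → ℝ) (tab : Pat3 → Pat3 → ℤ) :
    tvalC (fun n => w (n + 4 * Fintype.card V)) (E₁ ∪ E₂) (C₁ ∪ C₂) u s t tab =
      ∑ γ₁ ∈ E₁.powerset, ∑ γ₂ ∈ E₂.powerset, ∑ γ₃ ∈ (∅ : Finset (Sym2 V)).powerset,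
        w (apExpC E₁ C₁ γ₁ + apExpC E₂ C₂ γ₂ + apExpC ∅ ∅ γ₃ +
              corrC3 (pat3 (γ₁ ∪ C₁) u v s) (pat3 (γ₂ ∪ C₂) u v t) (pat3 (γ₃ ∪ ∅) u v s) +
            corrC3 (pat3 (E₁ \ γ₁ ∪ C₁) u v s) (pat3 (E₂ \ γ₂ ∪ C₂) u v t) (pat3 (∅ \ γ₃ ∪ ∅) u v s)) *
          (tab (joinC3 (pat3 (γ₁ ∪ C₁) u v s) (pat3 (γ₂ ∪ C₂) u v t) (pat3 (γ₃ ∪ ∅) u v s))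
            (joinC3 (pat3 (E₁ \ γ₁ ∪ C₁) u v s) (pat3 (E₂ \ γ₂ ∪ C₂) u v t) (pat3 (∅ \ γ₃ ∪ ∅) u v s)) : ℝ) := by
  have hd : Disjoint E₁ E₂ := Finset.disjoint_of_subset_left hE₁ (Finset.disjoint_of_subset_right hE₂ hdN)
  have h2 := tvalC_union2_corner hd (span_sub_of_subset h₁ hE₁ hC₁) (span_sub_of_subset h₂ hE₂ hC₂) h12 huv hs2 ht1 hsu hsv
    htu htv hst (fun m => w (m + 2 * Fintype.card V)) tab
  beta_reduce at h2
  have e : (fun n => w (n + 4 * Fintype.card V)) = fun n => w (n + 2 * Fintype.card V + 2 * Fintype.card V) := by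
    funext n
    congr 1
    ring
  rw [e, h2]
  refine Finset.sum_congr rfl fun γ₁ _ => Finset.sum_congr rfl fun γ₂ _ => ?_
  simp only [Finset.powerset_empty, Finset.sum_singleton, apExpC_empty_empty, joinC3, corrC3]
  congr 2
  ring

/-- **THE CORNER product-cone lemma ON MINORS from data** (`Prod2G`, symmetrised certificate over `joinC3`/`corrC3`): two
two-terminal series–parallel `(u, v)`-pieces `N₁ ∋ s`, `N₂ ∋ t` (inner marks) in parallel, minors `(E_i, C_i)` of the pieces ⇒
`0 ≤ D · lev2C (E₁ ∪ E₂) (C₁ ∪ C₂) u s t T λ`. [cite: AyyerLinussonRavichandran2025, §7 (p. 22)] -/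
theorem cornerC_level_nonneg_of_symCertG {u v s t : V} (hdN : Disjoint N₁ N₂) (h₁ : ∀ e ∈ (↑N₁ : Set (Sym2 V)), ∀ z ∈ e, z ∈ V₁)
    (h₂ : ∀ e ∈ (↑N₂ : Set (Sym2 V)), ∀ z ∈ e, z ∈ V₂) (hE₁ : E₁ ⊆ N₁) (hC₁ : C₁ ⊆ N₁) (hE₂ : E₂ ⊆ N₂) (hC₂ : C₂ ⊆ N₂)
    (h12 : V₁ ∩ V₂ ⊆ ({u, v} : Set V)) (huv : u ≠ v)
    (hs2 : s ∉ V₂) (ht1 : t ∉ V₁) (hsu : s ≠ u) (hsv : s ≠ v) (htu : t ≠ u) (htv : t ≠ v) (hst : s ≠ t)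
    (h1sp : IsTTSP N₁ u v) (h2sp : IsTTSP N₂ u v) (hs1 : ∃ e ∈ N₁, s ∈ e) (ht2 : ∃ e ∈ N₂, t ∈ e)
    (T : ℕ → Pat3 → Pat3 → ℤ) (D : ℕ) (prods : List Prod2G) (hok : (prods.all Prod2G.okC) = true)
    (hcert : ∀ d : ℕ, ∀ P1 Q1 P2 Q2 P3 Q3 : Pat3,
      8 * ∑ j : Fin (prods.map Prod2G.toProd3).length,
          (((prods.map Prod2G.toProd3).get j).lam : ℤ) * ((prods.map Prod2G.toProd3).get j).tensor d P1 Q1 P2 Q2 P3 Q3 ≤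
        D * target3Sym joinC3 corrC3 T d P1 Q1 P2 Q2 P3 Q3)
    (lam : ℕ) : 0 ≤ (D : ℤ) * lev2C (E₁ ∪ E₂) (C₁ ∪ C₂) u s t T lam := by
  refine cone3C_level_nonneg_sym (EK := E₁) (CK := C₁) (E₁ := E₂) (C₁ := C₂) (E₂ := (∅ : Finset (Sym2 V)))
    (C₂ := (∅ : Finset (Sym2 V))) (uK := u) (vK := v) (mK := s) (u₁ := u) (v₁ := v) (m₁ := t) (u₂ := u) (v₂ := v) (m₂ := s)
    joinC3 corrC3 (4 * Fintype.card V)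
    (fun w tab => hdec_cornerC hdN h₁ h₂ hE₁ hC₁ hE₂ hC₂ h12 huv hs2 ht1 hsu hsv htu htv hst w tab) T D Finset.univ
    (fun j => (prods.map Prod2G.toProd3).get j) hcert (fun j _ μ => ?_) lam
  have hp : (prods.map Prod2G.toProd3).get j ∈ prods.map Prod2G.toProd3 := List.get_mem _ j
  rw [List.mem_map] at hp
  obtain ⟨g, hg, hgj⟩ := hp
  rw [← hgj]
  rw [List.all_eq_true] at hok
  have h := hok g hg
  simp only [Prod2G.okC, Bool.and_eq_true] at h
  exact ⟨Gen.lev2C_nonneg h1sp hE₁ hC₁ hs1 hsu hsv _ h.1 μ, Gen.lev2C_nonneg h2sp hE₂ hC₂ ht2 htu htv _ h.2 μ,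
    lev2C_one2_nonneg _ _ u v s μ⟩

/-! #### The unmarked 1-cut -/

/-- The 1-CUT decomposition of a glued minor in the three-piece shape (second piece read on `(w, y, y)`, empty third piece). [folklore] -/
theorem hdec_cut1C {w : V} (hdN : Disjoint N₁ N₂) (h₁ : ∀ e ∈ (↑N₁ : Set (Sym2 V)), ∀ z ∈ e, z ∈ V₁)
    (h₂ : ∀ e ∈ (↑N₂ : Set (Sym2 V)), ∀ z ∈ e, z ∈ V₂) (hE₁ : E₁ ⊆ N₁) (hC₁ : C₁ ⊆ N₁) (hE₂ : E₂ ⊆ N₂) (hC₂ : C₂ ⊆ N₂)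
    (hS : V₁ ∩ V₂ ⊆ ({w} : Set V)) {x y s : V} (hxV : x ∉ V₂)
    (hsV : s ∉ V₂) (hyV : y ∉ V₁) (hxw : x ≠ w) (hyw : y ≠ w) (hxy : x ≠ y) (hsw : s ≠ w) (hsy : s ≠ y)
    (wt : ℕ → ℝ) (tab : Pat3 → Pat3 → ℤ) :
    tvalC (fun n => wt (n + 4 * Fintype.card V)) (E₁ ∪ E₂) (C₁ ∪ C₂) x y s tab =
      ∑ γ₁ ∈ E₁.powerset, ∑ γ₂ ∈ E₂.powerset, ∑ γ₃ ∈ (∅ : Finset (Sym2 V)).powerset,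
        wt (apExpC E₁ C₁ γ₁ + apExpC E₂ C₂ γ₂ + apExpC ∅ ∅ γ₃ +
              corrR3 (pat3 (γ₁ ∪ C₁) x w s) (pat3 (γ₂ ∪ C₂) w y y) (pat3 (γ₃ ∪ ∅) x w s) +
            corrR3 (pat3 (E₁ \ γ₁ ∪ C₁) x w s) (pat3 (E₂ \ γ₂ ∪ C₂) w y y) (pat3 (∅ \ γ₃ ∪ ∅) x w s)) *
          (tab (joinR3 (pat3 (γ₁ ∪ C₁) x w s) (pat3 (γ₂ ∪ C₂) w y y) (pat3 (γ₃ ∪ ∅) x w s))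
            (joinR3 (pat3 (E₁ \ γ₁ ∪ C₁) x w s) (pat3 (E₂ \ γ₂ ∪ C₂) w y y) (pat3 (∅ \ γ₃ ∪ ∅) x w s)) : ℝ) := by
  have hd : Disjoint E₁ E₂ := Finset.disjoint_of_subset_left hE₁ (Finset.disjoint_of_subset_right hE₂ hdN)
  have h2 := tvalC_union2_cut1 hd (span_sub_of_subset h₁ hE₁ hC₁) (span_sub_of_subset h₂ hE₂ hC₂) hS hxV hsV hyV hxw hyw hxy
    hsw hsy (fun m => wt (m + 2 * Fintype.card V)) tab
  beta_reduce at h2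
  have e : (fun n => wt (n + 4 * Fintype.card V)) = fun n => wt (n + 2 * Fintype.card V + 2 * Fintype.card V) := by
    funext n
    congr 1
    ring
  rw [e, h2]
  refine Finset.sum_congr rfl fun γ₁ _ => Finset.sum_congr rfl fun γ₂ _ => ?_
  simp only [Finset.powerset_empty, Finset.sum_singleton, apExpC_empty_empty, joinR3, corrR3, add_zero, pat3_xy]

/-- **The 1-CUT product-cone lemma ON MINORS with validity HYPOTHESES**: glued minor `(E₁ ∪ E₂, C₁ ∪ C₂)` of pieces
`N₁ ⊇ E₁, C₁` (marks `x, s`) and `N₂ ⊇ E₂, C₂` (mark `y`) meeting in the unmarked vertex `w`; generator validity on the minor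
`(E₁, C₁)` read on `(x, w, s)` is ASSUMED. [cite: AyyerLinussonRavichandran2025, §7 (p. 22)] -/
theorem cut1C_level_nonneg_of_symCert {w : V} (hdN : Disjoint N₁ N₂) (h₁ : ∀ e ∈ (↑N₁ : Set (Sym2 V)), ∀ z ∈ e, z ∈ V₁)
    (h₂ : ∀ e ∈ (↑N₂ : Set (Sym2 V)), ∀ z ∈ e, z ∈ V₂) (hE₁ : E₁ ⊆ N₁) (hC₁ : C₁ ⊆ N₁) (hE₂ : E₂ ⊆ N₂) (hC₂ : C₂ ⊆ N₂)
    (hS : V₁ ∩ V₂ ⊆ ({w} : Set V)) {x y s : V} (hxV : x ∉ V₂)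
    (hsV : s ∉ V₂) (hyV : y ∉ V₁) (hxw : x ≠ w) (hyw : y ≠ w) (hxy : x ≠ y) (hsw : s ≠ w) (hsy : s ≠ y)
    (T : ℕ → Pat3 → Pat3 → ℤ) (D : ℕ) {ι : Type*} (J : Finset ι) (prod : ι → Prod3)
    (hcert : ∀ d : ℕ, ∀ P1 Q1 P2 Q2 P3 Q3 : Pat3,
      8 * ∑ j ∈ J, ((prod j).lam : ℤ) * (prod j).tensor d P1 Q1 P2 Q2 P3 Q3 ≤ D * target3Sym joinR3 corrR3 T d P1 Q1 P2 Q2 P3 Q3)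
    (hval : ∀ j ∈ J, ∀ μ : ℕ, 0 ≤ lev2C E₁ C₁ x w s (prod j).gK μ ∧ 0 ≤ lev2C E₂ C₂ w y y (prod j).g1 μ ∧
      0 ≤ lev2C (∅ : Finset (Sym2 V)) ∅ x w s (prod j).g2 μ)
    (lam : ℕ) : 0 ≤ (D : ℤ) * lev2C (E₁ ∪ E₂) (C₁ ∪ C₂) x y s T lam :=
  cone3C_level_nonneg_sym (EK := E₁) (CK := C₁) (E₁ := E₂) (C₁ := C₂) (E₂ := (∅ : Finset (Sym2 V)))
    (C₂ := (∅ : Finset (Sym2 V))) (uK := x) (vK := w) (mK := s) (u₁ := w) (v₁ := y) (m₁ := y) (u₂ := x) (v₂ := w) (m₂ := s)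
    joinR3 corrR3 (4 * Fintype.card V)
    (fun wt tab => hdec_cut1C hdN h₁ h₂ hE₁ hC₁ hE₂ hC₂ hS hxV hsV hyV hxw hyw hxy hsw hsy wt tab) T D J prod hcert hval lam

/-! #### The marked 1-cut -/

/-- The MARKED-1-CUT decomposition of a glued minor in the three-piece shape (sides read on `(x, s, s)` and `(s, y, y)`, empty
third piece). [folklore] -/
theorem hdec_cutSC (hdN : Disjoint N₁ N₂) (h₁ : ∀ e ∈ (↑N₁ : Set (Sym2 V)), ∀ z ∈ e, z ∈ V₁)
    (h₂ : ∀ e ∈ (↑N₂ : Set (Sym2 V)), ∀ z ∈ e, z ∈ V₂) (hE₁ : E₁ ⊆ N₁) (hC₁ : C₁ ⊆ N₁) (hE₂ : E₂ ⊆ N₂) (hC₂ : C₂ ⊆ N₂)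
    {s : V} (hS : V₁ ∩ V₂ ⊆ ({s} : Set V)) {x y : V} (hxV : x ∉ V₂)
    (hyV : y ∉ V₁) (hxs : x ≠ s) (hys : y ≠ s) (hxy : x ≠ y) (wt : ℕ → ℝ) (tab : Pat3 → Pat3 → ℤ) :
    tvalC (fun n => wt (n + 4 * Fintype.card V)) (E₁ ∪ E₂) (C₁ ∪ C₂) x y s tab =
      ∑ γ₁ ∈ E₁.powerset, ∑ γ₂ ∈ E₂.powerset, ∑ γ₃ ∈ (∅ : Finset (Sym2 V)).powerset,
        wt (apExpC E₁ C₁ γ₁ + apExpC E₂ C₂ γ₂ + apExpC ∅ ∅ γ₃ +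
              corrR3 (pat3 (γ₁ ∪ C₁) x s s) (pat3 (γ₂ ∪ C₂) s y y) (pat3 (γ₃ ∪ ∅) x s s) +
            corrR3 (pat3 (E₁ \ γ₁ ∪ C₁) x s s) (pat3 (E₂ \ γ₂ ∪ C₂) s y y) (pat3 (∅ \ γ₃ ∪ ∅) x s s)) *
          (tab (joinS3 (pat3 (γ₁ ∪ C₁) x s s) (pat3 (γ₂ ∪ C₂) s y y) (pat3 (γ₃ ∪ ∅) x s s))
            (joinS3 (pat3 (E₁ \ γ₁ ∪ C₁) x s s) (pat3 (E₂ \ γ₂ ∪ C₂) s y y) (pat3 (∅ \ γ₃ ∪ ∅) x s s)) : ℝ) := by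
  have hd : Disjoint E₁ E₂ := Finset.disjoint_of_subset_left hE₁ (Finset.disjoint_of_subset_right hE₂ hdN)
  have h2 := tvalC_union2_cutS hd (span_sub_of_subset h₁ hE₁ hC₁) (span_sub_of_subset h₂ hE₂ hC₂) hS hxV hyV hxs hys hxy
    (fun m => wt (m + 2 * Fintype.card V)) tab
  beta_reduce at h2
  have e : (fun n => wt (n + 4 * Fintype.card V)) = fun n => wt (n + 2 * Fintype.card V + 2 * Fintype.card V) := by
    funext n
    congr 1
    ring
  rw [e, h2]
  refine Finset.sum_congr rfl fun γ₁ _ => Finset.sum_congr rfl fun γ₂ _ => ?_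
  simp only [Finset.powerset_empty, Finset.sum_singleton, apExpC_empty_empty, joinS3, corrR3, add_zero, pat3_xy]

/-- **The MARKED-1-CUT product-cone lemma ON MINORS with validity hypotheses** (in census g36's certificates the product list is
empty, so the hypotheses are vacuous). [cite: AyyerLinussonRavichandran2025, §7 (p. 22)] -/
theorem cutSC_level_nonneg_of_symCert (hdN : Disjoint N₁ N₂) (h₁ : ∀ e ∈ (↑N₁ : Set (Sym2 V)), ∀ z ∈ e, z ∈ V₁)
    (h₂ : ∀ e ∈ (↑N₂ : Set (Sym2 V)), ∀ z ∈ e, z ∈ V₂) (hE₁ : E₁ ⊆ N₁) (hC₁ : C₁ ⊆ N₁) (hE₂ : E₂ ⊆ N₂) (hC₂ : C₂ ⊆ N₂)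
    {s : V} (hS : V₁ ∩ V₂ ⊆ ({s} : Set V)) {x y : V} (hxV : x ∉ V₂)
    (hyV : y ∉ V₁) (hxs : x ≠ s) (hys : y ≠ s) (hxy : x ≠ y)
    (T : ℕ → Pat3 → Pat3 → ℤ) (D : ℕ) {ι : Type*} (J : Finset ι) (prod : ι → Prod3)
    (hcert : ∀ d : ℕ, ∀ P1 Q1 P2 Q2 P3 Q3 : Pat3,
      8 * ∑ j ∈ J, ((prod j).lam : ℤ) * (prod j).tensor d P1 Q1 P2 Q2 P3 Q3 ≤ D * target3Sym joinS3 corrR3 T d P1 Q1 P2 Q2 P3 Q3)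
    (hval : ∀ j ∈ J, ∀ μ : ℕ, 0 ≤ lev2C E₁ C₁ x s s (prod j).gK μ ∧ 0 ≤ lev2C E₂ C₂ s y y (prod j).g1 μ ∧
      0 ≤ lev2C (∅ : Finset (Sym2 V)) ∅ x s s (prod j).g2 μ)
    (lam : ℕ) : 0 ≤ (D : ℤ) * lev2C (E₁ ∪ E₂) (C₁ ∪ C₂) x y s T lam :=
  cone3C_level_nonneg_sym (EK := E₁) (CK := C₁) (E₁ := E₂) (C₁ := C₂) (E₂ := (∅ : Finset (Sym2 V)))
    (C₂ := (∅ : Finset (Sym2 V))) (uK := x) (vK := s) (mK := s) (u₁ := s) (v₁ := y) (m₁ := y) (u₂ := x) (v₂ := s) (m₂ := s)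
    joinS3 corrR3 (4 * Fintype.card V)
    (fun wt tab => hdec_cutSC hdN h₁ h₂ hE₁ hC₁ hE₂ hC₂ hS hxV hyV hxs hys hxy wt tab) T D J prod hcert hval lam

end MinorCuts

end FK

end Summit.CriticalPhenomena.PercolationContinuityZ3.Theorems

end
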